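import Summits.ResolutionOfSingularities.ResolutionOfSingularities.Theorems.FrobeniusLadderFInjectiveMacaulayficationFullLastCentreDefs
import HarnessLib

/-!
# LAST-CENTRE CALCULUS — DEFINITIONS II: the minimal normal degree `ν` and the DROP-POINT BUDGET
# (crux `FInjectiveMacaulayfication` stmt-ResolutionOfSingularities-15315, chain w45a; companion of `…FullLastCentreDefs` ✓p727906; used by the crux workfile
# `Cruxes/FInjectiveMacaulayfication/Lines/T_canon_door.lean` v6.2+ (desk R26.21 (β)) and by instance files; seat res-L1-w45a-lead-1 g16)

[OURS · L1 W4.5a] Support file (`--supports stmt-ResolutionOfSingularities-15315 --as helper`); DEFINITIONS ONLY (no theorem, no instance, no notation, no named fact);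
replaces the role of NO printed item; NOT a statement of any manuscript. AI-written (AI review is weaker than expert review).
* `IsMinNorDeg Nor N ν` — `ν` is the least normal degree along `Z = V(x, y_n : n ∈ Nor)` of a monomial of `N` (`ν = ord_{η_Z} N`), attained.
* `DropBudget S` — the drop-point budget `ord₀ Disc_x(P) ≤ 8 + 2·Σ_{E ∋ x} d_E` (K4 in the Weierstrass letter at a double point; NOT implied by the toric scheme `Budgeted`,
  desk R26.21): some monomial of `Disc_x P` has total degree `≤ 8 + 2·Σ_{n ∈ Exc} d_n`.
-/

-- single-problem summit: the doubled namespace component is forced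
set_option linter.dupNamespace false

noncomputable section

open MvPolynomial Finsupp

namespace Summit.ResolutionOfSingularities.ResolutionOfSingularities.Theorems.FInjectiveMacaulayfication.LastCentreDefs

variable {k : Type} [Field k]

/-- MINIMAL NORMAL DEGREE: `ν` is the least normal degree along `Z = V(x, y_n : n ∈ Nor)` of a monomial of `N`, and it is attained (`ν = ord_{η_Z} N`).
[OURS · L1 W4.5a · definition; folklore] -/
def IsMinNorDeg (Nor : Finset Letter) (N : YPoly k) (ν : ℕ) : Prop :=
  (∃ e ∈ N.support, norDeg Nor e = ν) ∧ ∀ e ∈ N.support, ν ≤ norDeg Nor e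

/-- THE DROP-POINT BUDGET at a stage: some monomial of `Disc_x P` has total degree `≤ 8 + 2·Σ_{n ∈ Exc} d_n` (`ω ≤ Bud`; at a double point this is K4 applied in the
Weierstrass letter `x̃ = x + B/2`). [OURS · L1 W4.5a · definition; folklore] -/
def DropBudget (S : Stage k) : Prop :=
  ∃ e ∈ S.D.support, (tdeg e : ℤ) ≤ 8 + 2 * ∑ n ∈ S.Exc, S.d n

end Summit.ResolutionOfSingularities.ResolutionOfSingularities.Theorems.FInjectiveMacaulayfication.LastCentreDefs

end
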